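import Summits.Ventures.CertifiedManyBodySolver.Downfold.TppSeamOrderFilling
import Literature.MathematicalPhysics.QuantumLattice.DWaveOrderParameterTPrimeCells
import HarnessLib

/-!
# The order word at the box's own filling from TWO sourced corner floors: the `t'` transport cost vanishes

Venture CertifiedManyBodySolver, cell `pub/hubbard-downfold` (stage S1 ↔ S2 seam), seat hubbard-downfold-mod-1;
namespace `Summit.Ventures.CertifiedManyBodySolver.Downfold`. Sequel of `TppSeamOrderFilling.lean` (p486156/p488734),
whose single-anchor form pays `4·eS.dev t'₀` for the `t'` direction (operator-norm row). hubbard-downfold-unc-3 (g6,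
INBOX 2026-08-27T02:33:42Z) pointed to hubbard-box-p3's rows of record for the sourced energy density in `t'`
(`Literature/…/DWaveOrderParameterTPrimeCells.lean`, p483408): `e_src` is CONCAVE in `t'`, so TWO floors at the
box's `t'`-ENDS serve the whole `t'`-interval with ZERO loss (`dWaveSourceEnergyDensityTT'_tPrime_interval_ge`), and
with the corner at the box's LOWER `U/t` edge they serve `[s₁, s₂] × [U₁, ∞)` (`…_box_ge_of_lowerCorners`, monotone
in `U`). Hence, with the same canonical argument as before:

* `holdsOn_pairAmplitude_le_of_lowerCorners_filling` — box `B` (entries `eU, eS, eSS, eN`), the canonical S2 window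
  `[L, R]`, and TWO sourced floors `lo₁ ≤ e_src(eS.lo, eU.lo, μ₀, h)`, `lo₂ ≤ e_src(eS.hi, eU.lo, μ₀, h)`, `h > 0`
  ⇒ on `B`, every translation-invariant `ε`-near canonical minimiser of object M at the member's couplings and
  filling has `e_P(σ) ≤ (R − μ₀·n − min lo₁ lo₂ + (32/π²)·m + ε)/h` — the ONLY transport cost left is the `t''`
  seam `(32/π²)·m`;
* `holdsOn_pairAmplitude_le_of_lowerCorners_filling_objE` — object E (`eSS = [0,0]`): `e_P(σ) ≤ (R − μ₀·n − min lo₁ lo₂ + ε)/h`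
  — NO transport cost at all: two sourced floors at the corners `(tp.lo, U.lo)`, `(tp.hi, U.lo)` and the box's own
  window cap;
* instances: `boxLa214M_M15_pairAmplitude_le_lowerCorners_filling` (corners `(−17/100, 63/10)`, `(−3/100, 63/10)`;
  cost `(32/π²)(7/50) ≤ 0.454`), `boxLa214E_M15_pairAmplitude_le_lowerCorners_filling` (corners `(−3/10, 79/10)`,
  `(−1/5, 79/10)`; cost `0`), `boxCCOCE_M36_pairAmplitude_le_lowerCorners_filling` (corners `(−41/100, 71/10)`,
  `(−3/10, 71/10)`; cost `0`).

Price on the S2 side: two sourced floors per box instead of one (same `U₀ = eU.lo`, `μ₀`, `h`). Everything here is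
PROVED; no new definition. HONEST FRAMING as in the parent files: variational ceiling/ABSENT side; nothing floors
order; no number about any material certified here.
-/

noncomputable section

namespace Summit.Ventures.CertifiedManyBodySolver.Downfold

open NonemptyInterval Literature.MathematicalPhysics.QuantumLattice
  Literature.MathematicalPhysics.QuantumLattice.ThermodynamicLimit Literature.Probability.LatticeModels

/-- **THE ORDER WORD AT THE BOX'S OWN FILLING FROM TWO LOWER-CORNER FLOORS.** Let `B` carry entries `eU, eS, eSS, eN`
(`U/t`, `tp/t`, `tpp/t`, `n`; `eU.lo ≥ 0`, `0 < eN.lo`, `eN.hi < 2`), let S2 state the canonical `_word_Icc` window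
`[L, R]` on the cell, and let TWO sourced floors hold at the lower-`U` corners of the `(tp/t, U/t)` face:
`lo₁ ≤ e_src(eS.lo, eU.lo, μ₀, h)`, `lo₂ ≤ e_src(eS.hi, eU.lo, μ₀, h)`, `h > 0`. Then on `B`, for every `ε` and every
translation-invariant `σ` with `σ.density = p n` whose source-free object-M mean energy is within `ε` of `e^M_{p n}`:
`e_P(σ) ≤ (R − μ₀·(p n) − min lo₁ lo₂ + (32/π²)·m + ε)/h`. [cite: KomaTasaki1994, §1] -/
theorem holdsOn_pairAmplitude_le_of_lowerCorners_filling {B : OneBandBox} {eU eS eSS eN : Entry}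
    (hU : B .UOverT = some eU) (hS : B .tpOverT = some eS) (hSS : B .tppOverT = some eSS)
    (hN : B .filling = some eN) (hU0 : 0 ≤ eU.encl.fst) (hN0 : 0 < eN.encl.fst) (hN2 : eN.encl.snd < 2)
    {L R : ℝ}
    (hE : ∀ θ ∈ Set.Icc (s2Lo eU eS eN) (s2Hi eU eS eN),
      L ≤ energyDensityTT' 1 (θ 1) (θ 0) (θ 2) ∧ energyDensityTT' 1 (θ 1) (θ 0) (θ 2) ≤ R)
    {μ₀ h lo₁ lo₂ : ℝ} (hh : 0 < h)
    (hlo₁ : lo₁ ≤ dWaveSourceEnergyDensityTT' ((eS.encl.fst : ℚ) : ℝ) ((eU.encl.fst : ℚ) : ℝ) μ₀ h)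
    (hlo₂ : lo₂ ≤ dWaveSourceEnergyDensityTT' ((eS.encl.snd : ℚ) : ℝ) ((eU.encl.fst : ℚ) : ℝ) μ₀ h) :
    HoldsOn (fun p : OneBandCoord → ℝ => ∀ (ε : ℝ) (σ : InfVolFermionState 2), σ.IsTranslationInvariant →
      σ.density = p .filling →
      σ.meanEnergy (hubbardTT'T''FermionInteraction 1 (p .tpOverT) (p .tppOverT) (p .UOverT)) 2 ≤
        (hubbardTT'T''FermionInteraction 1 (p .tpOverT) (p .tppOverT) (p .UOverT)).tiGroundEnergyDensityAt 2
          (p .filling) + ε →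
      σ.meanEnergy (pairSourceInteraction dWaveFormFactor) 1 ≤
        (R - μ₀ * p .filling - min lo₁ lo₂ +
          32 / Real.pi ^ 2 * ((max |eSS.encl.fst| |eSS.encl.snd| : ℚ) : ℝ) + ε) / h) B := by
  intro p hp ε σ hσ hρ hε
  -- (1) canonical cap on the box (fixed-filling seam, kinematic constant)
  have hcap := (holdsOn_tiGroundEnergyDensityAt_objectM_kinematic hU hS hSS hN hU0 hN0 hN2 hE p hp).2
  -- (2) sourced grand-canonical principle at (p, μ₀, h)
  have hvar := (hubbardTT'T''SourcedInteraction 1 (p .tpOverT) (p .tppOverT) (p .UOverT) μ₀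
    dWaveFormFactor h).tiGroundEnergyDensity_le_meanEnergy 2 hσ
  rw [σ.meanEnergy_hubbardTT'T''Sourced 1 (p .tpOverT) (p .tppOverT) (p .UOverT) μ₀ dWaveFormFactor h,
    hρ] at hvar
  -- (3) the two corner floors serve the member's (tp, U) with zero loss (concave in t', monotone in U)
  have hSmem := mem_ratCast_iff.1 (hp _ _ hS)
  have hUmem := mem_ratCast_iff.1 (hp _ _ hU)
  have h2 := dWaveSourceEnergyDensityTT'_box_ge_of_lowerCorners hSmem.1 hSmem.2 hUmem.1 (le_refl μ₀) hlo₁ hlo₂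
  have h3 := tiGroundEnergyDensity_tppSourced_ge_of_le h2 (p .tppOverT)
  have h4 : |p .tppOverT| ≤ ((max |eSS.encl.fst| |eSS.encl.snd| : ℚ) : ℝ) := Entry.abs_le_of_mem (hp _ _ hSS)
  have hπ : 0 ≤ 16 / Real.pi ^ 2 := by positivity
  rw [le_div_iff₀ hh]
  have h32 : 32 / Real.pi ^ 2 * ((max |eSS.encl.fst| |eSS.encl.snd| : ℚ) : ℝ) =
      2 * (16 / Real.pi ^ 2 * ((max |eSS.encl.fst| |eSS.encl.snd| : ℚ) : ℝ)) := by ring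
  rw [h32]
  nlinarith [mul_le_mul_of_nonneg_left h4 hπ]

/-- **Object-E form, two lower-corner floors — NO transport cost.** With `eSS = [0, 0]`, the window `[L, R]` and the two
floors `lo₁ ≤ e_src(eS.lo, eU.lo, μ₀, h)`, `lo₂ ≤ e_src(eS.hi, eU.lo, μ₀, h)`: on `B`, every translation-invariant `σ`
with `σ.density = p n` and `e^{tt'}(σ) ≤ energyDensityTT' 1 (p tp) (p U) (p n) + ε` has
`e_P(σ) ≤ (R − μ₀·(p n) − min lo₁ lo₂ + ε)/h`. [cite: KomaTasaki1994, §1] -/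
theorem holdsOn_pairAmplitude_le_of_lowerCorners_filling_objE {B : OneBandBox} {eU eS eSS eN : Entry}
    (hU : B .UOverT = some eU) (hS : B .tpOverT = some eS) (hSS : B .tppOverT = some eSS)
    (hN : B .filling = some eN) (hU0 : 0 ≤ eU.encl.fst) (hN0 : 0 < eN.encl.fst) (hN2 : eN.encl.snd < 2)
    (hSS0 : eSS.encl.fst = 0) (hSS1 : eSS.encl.snd = 0)
    {L R : ℝ}
    (hE : ∀ θ ∈ Set.Icc (s2Lo eU eS eN) (s2Hi eU eS eN),
      L ≤ energyDensityTT' 1 (θ 1) (θ 0) (θ 2) ∧ energyDensityTT' 1 (θ 1) (θ 0) (θ 2) ≤ R)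
    {μ₀ h lo₁ lo₂ : ℝ} (hh : 0 < h)
    (hlo₁ : lo₁ ≤ dWaveSourceEnergyDensityTT' ((eS.encl.fst : ℚ) : ℝ) ((eU.encl.fst : ℚ) : ℝ) μ₀ h)
    (hlo₂ : lo₂ ≤ dWaveSourceEnergyDensityTT' ((eS.encl.snd : ℚ) : ℝ) ((eU.encl.fst : ℚ) : ℝ) μ₀ h) :
    HoldsOn (fun p : OneBandCoord → ℝ => ∀ (ε : ℝ) (σ : InfVolFermionState 2), σ.IsTranslationInvariant →
      σ.density = p .filling →
      σ.meanEnergy (hubbardTTPrimeFermionInteraction 1 (p .tpOverT) (p .UOverT)) 1 ≤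
        energyDensityTT' 1 (p .tpOverT) (p .UOverT) (p .filling) + ε →
      σ.meanEnergy (pairSourceInteraction dWaveFormFactor) 1 ≤ (R - μ₀ * p .filling - min lo₁ lo₂ + ε) / h) B := by
  intro p hp ε σ hσ hρ hε
  have hm : (max |eSS.encl.fst| |eSS.encl.snd| : ℚ) = 0 := by rw [hSS0, hSS1]; norm_num
  have h0 : p .tppOverT = 0 := by
    have hmem := mem_ratCast_iff.1 (hp _ _ hSS)
    rw [hSS0, hSS1] at hmem
    push_cast at hmem
    linarith [hmem.1, hmem.2]
  obtain ⟨hu0, hn0, hn2⟩ := mem_sideConditions hU hN hU0 hN0 hN2 hp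
  have hk := holdsOn_pairAmplitude_le_of_lowerCorners_filling hU hS hSS hN hU0 hN0 hN2 hE hh hlo₁ hlo₂ p hp ε σ hσ hρ
  rw [hm, h0, hubbardTT'T''FermionInteraction_zero,
    tiGroundEnergyDensityAt_hubbardTTPrime_eq_energyDensityTT'_of_one_le 1 (p .tpOverT) hu0 (by norm_num : (1 : ℝ) ≤ 2)
      hn0 hn2,
    σ.meanEnergy_hubbardTTPrime_eq_one 1 (p .tpOverT) (p .UOverT) (by norm_num : (1 : ℝ) ≤ 2)] at hk
  have hk' := hk hε
  have hc : (((0 : ℚ)) : ℝ) = 0 := by norm_num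
  rw [hc, mul_zero, add_zero] at hk'
  exact hk'

/-- **La-214 M15, object M, two lower-corner floors** at `(tp/t, U/t) = (−17/100, 63/10)` and `(−3/100, 63/10)`:
`e_P(σ) ≤ (R − μ₀·n − min lo₁ lo₂ + (32/π²)(7/50) + ε)/h` — only the `t''` seam `≤ 0.454 t` remains.
[cite: KomaTasaki1994, §1] -/
theorem boxLa214M_M15_pairAmplitude_le_lowerCorners_filling {L R μ₀ h lo₁ lo₂ : ℝ}
    (hE : ∀ θ ∈ Set.Icc (![63/10, -17/100, 171/200] : Fin 3 → ℝ) ![137/10, -3/100, 179/200],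
      L ≤ energyDensityTT' 1 (θ 1) (θ 0) (θ 2) ∧ energyDensityTT' 1 (θ 1) (θ 0) (θ 2) ≤ R)
    (hh : 0 < h) (hlo₁ : lo₁ ≤ dWaveSourceEnergyDensityTT' (-17/100) (63/10) μ₀ h)
    (hlo₂ : lo₂ ≤ dWaveSourceEnergyDensityTT' (-3/100) (63/10) μ₀ h) :
    HoldsOn (fun p : OneBandCoord → ℝ => ∀ (ε : ℝ) (σ : InfVolFermionState 2), σ.IsTranslationInvariant →
      σ.density = p .filling →
      σ.meanEnergy (hubbardTT'T''FermionInteraction 1 (p .tpOverT) (p .tppOverT) (p .UOverT)) 2 ≤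
        (hubbardTT'T''FermionInteraction 1 (p .tpOverT) (p .tppOverT) (p .UOverT)).tiGroundEnergyDensityAt 2
          (p .filling) + ε →
      σ.meanEnergy (pairSourceInteraction dWaveFormFactor) 1 ≤
        (R - μ₀ * p .filling - min lo₁ lo₂ + 32 / Real.pi ^ 2 * (7/50 : ℝ) + ε) / h) boxLa214M_M15 := by
  have hk := holdsOn_pairAmplitude_le_of_lowerCorners_filling (B := boxLa214M_M15) (eU := la214M_M15_U)
    (eS := la214M_M15_tp) (eSS := la214M_M15_tpp) (eN := la214_M15_n) rfl rfl rfl rfl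
    (by rw [la214M_M15_U, Entry.encl_ofEnds_fst]; norm_num)
    (by rw [la214_M15_n, Entry.encl_ofEnds_fst]; norm_num)
    (by rw [la214_M15_n, Entry.encl_ofEnds_snd]; norm_num)
    (L := L) (R := R) (by rw [la214M_M15_s2Lo, la214M_M15_s2Hi]; exact hE) hh (μ₀ := μ₀) (lo₁ := lo₁) (lo₂ := lo₂)
    (by rw [la214M_M15_tp, la214M_M15_U, Entry.encl_ofEnds_fst, Entry.encl_ofEnds_fst]; push_cast
        convert hlo₁ using 2)
    (by rw [la214M_M15_tp, la214M_M15_U, Entry.encl_ofEnds_snd, Entry.encl_ofEnds_fst]; push_cast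
        convert hlo₂ using 2)
  rw [la214M_M15_tpp_abs] at hk
  have hc : (((7/50 : ℚ)) : ℝ) = (7/50 : ℝ) := by norm_num
  rw [hc] at hk
  exact hk

/-- **La-214 M15, OBJECT E, two lower-corner floors** at `(tp/t_eff, U/t_eff) = (−3/10, 79/10)` and `(−1/5, 79/10)`:
`e_P(σ) ≤ (R − μ₀·n − min lo₁ lo₂ + ε)/h` — no transport cost; with box-p2's cap `R = −0.4130954130` the ABSENT(`< m₀`)
budget is `h·m₀ > −0.4130954130 − μ₀·n − min lo₁ lo₂` at the worst filling of `[0.855, 0.895]`. [cite: KomaTasaki1994, §1] -/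
theorem boxLa214E_M15_pairAmplitude_le_lowerCorners_filling {L R μ₀ h lo₁ lo₂ : ℝ}
    (hE : ∀ θ ∈ Set.Icc (![79/10, -3/10, 171/200] : Fin 3 → ℝ) ![147/10, -1/5, 179/200],
      L ≤ energyDensityTT' 1 (θ 1) (θ 0) (θ 2) ∧ energyDensityTT' 1 (θ 1) (θ 0) (θ 2) ≤ R)
    (hh : 0 < h) (hlo₁ : lo₁ ≤ dWaveSourceEnergyDensityTT' (-3/10) (79/10) μ₀ h)
    (hlo₂ : lo₂ ≤ dWaveSourceEnergyDensityTT' (-1/5) (79/10) μ₀ h) :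
    HoldsOn (fun p : OneBandCoord → ℝ => ∀ (ε : ℝ) (σ : InfVolFermionState 2), σ.IsTranslationInvariant →
      σ.density = p .filling →
      σ.meanEnergy (hubbardTTPrimeFermionInteraction 1 (p .tpOverT) (p .UOverT)) 1 ≤
        energyDensityTT' 1 (p .tpOverT) (p .UOverT) (p .filling) + ε →
      σ.meanEnergy (pairSourceInteraction dWaveFormFactor) 1 ≤ (R - μ₀ * p .filling - min lo₁ lo₂ + ε) / h)
      boxLa214E_M15 :=
  holdsOn_pairAmplitude_le_of_lowerCorners_filling_objE (B := boxLa214E_M15) (eU := la214E_M15_U)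
    (eS := la214E_M15_tp) (eSS := la214E_M15_tpp) (eN := la214_M15_n) rfl rfl rfl rfl
    (by rw [la214E_M15_U, Entry.encl_ofEnds_fst]; norm_num)
    (by rw [la214_M15_n, Entry.encl_ofEnds_fst]; norm_num)
    (by rw [la214_M15_n, Entry.encl_ofEnds_snd]; norm_num)
    (by rw [la214E_M15_tpp, Entry.encl_ofEnds_fst]) (by rw [la214E_M15_tpp, Entry.encl_ofEnds_snd])
    (L := L) (R := R) (by rw [la214E_M15_s2Lo, la214E_M15_s2Hi]; exact hE) hh
    (by rw [la214E_M15_tp, la214E_M15_U, Entry.encl_ofEnds_fst, Entry.encl_ofEnds_fst]; push_cast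
        convert hlo₁ using 2)
    (by rw [la214E_M15_tp, la214E_M15_U, Entry.encl_ofEnds_snd, Entry.encl_ofEnds_fst]; push_cast
        convert hlo₂ using 2)

/-- **Na-CCOC M36, OBJECT E, two lower-corner floors** at `(−41/100, 71/10)` and `(−3/10, 71/10)`:
`e_P(σ) ≤ (R − μ₀·n − min lo₁ lo₂ + ε)/h` — no transport cost (cap of record `R = −0.3546462921`).
[cite: KomaTasaki1994, §1] -/
theorem boxCCOCE_M36_pairAmplitude_le_lowerCorners_filling {L R μ₀ h lo₁ lo₂ : ℝ}
    (hE : ∀ θ ∈ Set.Icc (![71/10, -41/100, 22/25] : Fin 3 → ℝ) ![62/5, -3/10, 23/25],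
      L ≤ energyDensityTT' 1 (θ 1) (θ 0) (θ 2) ∧ energyDensityTT' 1 (θ 1) (θ 0) (θ 2) ≤ R)
    (hh : 0 < h) (hlo₁ : lo₁ ≤ dWaveSourceEnergyDensityTT' (-41/100) (71/10) μ₀ h)
    (hlo₂ : lo₂ ≤ dWaveSourceEnergyDensityTT' (-3/10) (71/10) μ₀ h) :
    HoldsOn (fun p : OneBandCoord → ℝ => ∀ (ε : ℝ) (σ : InfVolFermionState 2), σ.IsTranslationInvariant →
      σ.density = p .filling →
      σ.meanEnergy (hubbardTTPrimeFermionInteraction 1 (p .tpOverT) (p .UOverT)) 1 ≤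
        energyDensityTT' 1 (p .tpOverT) (p .UOverT) (p .filling) + ε →
      σ.meanEnergy (pairSourceInteraction dWaveFormFactor) 1 ≤ (R - μ₀ * p .filling - min lo₁ lo₂ + ε) / h)
      boxCCOCE_M36 :=
  holdsOn_pairAmplitude_le_of_lowerCorners_filling_objE (B := boxCCOCE_M36) (eU := cCOCE_M36_U)
    (eS := cCOCE_M36_tp) (eSS := cCOCE_M36_tpp) (eN := cCOCE_M36_n) rfl rfl rfl rfl
    (by rw [cCOCE_M36_U, Entry.encl_ofEnds_fst]; norm_num)
    (by rw [cCOCE_M36_n, Entry.encl_ofEnds_fst]; norm_num)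
    (by rw [cCOCE_M36_n, Entry.encl_ofEnds_snd]; norm_num)
    (by rw [cCOCE_M36_tpp, Entry.encl_ofEnds_fst]) (by rw [cCOCE_M36_tpp, Entry.encl_ofEnds_snd])
    (L := L) (R := R) (by rw [cCOCE_M36_s2Lo, cCOCE_M36_s2Hi]; exact hE) hh
    (by rw [cCOCE_M36_tp, cCOCE_M36_U, Entry.encl_ofEnds_fst, Entry.encl_ofEnds_fst]; push_cast
        convert hlo₁ using 2)
    (by rw [cCOCE_M36_tp, cCOCE_M36_U, Entry.encl_ofEnds_snd, Entry.encl_ofEnds_fst]; push_cast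
        convert hlo₂ using 2)

end Summit.Ventures.CertifiedManyBodySolver.Downfold

end
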